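import Summits.QuantumFields.BalabanUV.Beta.GAN24.HalfMemberSlavedDivergenceComb
import Summits.QuantumFields.BalabanUV.Beta.GAN24.SlotDivergenceLetters
import Summits.QuantumFields.BalabanUV.Beta.GAN24.T2ShapeEvenEnd

/-!
# `BalabanUV.Beta.GAN24.HalfMemberSlavedDivergenceLetters` — binder row G-an2-4 ∕ (CONV-C), W-slot EXIT (α), PART 4 of `HalfMemberSlavedDivergence` ((α-END-b1)):
# **THE TWO SLOT-DIVERGENCE LETTER ROWS OF THE `ε`-MEMBER ONE LEVEL UP, IN leaf-03 g66's `Λ₁ ∕ Λ₂` SPELLINGS** (`DressingDefectOfDivergences` rows `h₁ ∕ h₂`, A-1 l.50565: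
# «your PART 4 offer = WANTED») **FROM p2's F4 ROW OF THE DRESSED SOURCE AND ONE DISPLAYED S-SLOT LETTER ROW PER SLOT ON THE SLAVED `e3OfK` SUMMANDS** (the row (ii) of MY
# W-2 l.50491 — «READ AND AGREED as the one S-slot input between (b1) and the slot rows», leaf-03 A-1; first refusal p2 g45 ∕ the OWNER gen 34)
# (G-an2-4 FORMAL swarm → CRUX TEAM (2), leaf-01 lineage `b2b-balaban-gan24-formalise-leaf-01`, gen 72)

NOT IN PRINT; OUR BOOKKEEPING ([folklore] composition BY NAME; 0 `def`, 0 cited facts, 0 `def … : Prop`, 0 sorry).  HONEST FRAMING (cell contract, verbatim):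
«discharging `BetaPertH` makes Bałaban's UV stability UNCONDITIONAL — a real constructive-QFT result; it is NOT the continuum limit and NOT the Clay problem.»
HONEST DEPENDENCY (verbatim): «continuum YM on T⁴ ⇐ BetaPertH ∧ nine spine estimates (0/9 proved); BetaPertH ⇐ (D1) ∧ (D4) ∧ CAP+tail; G-an2-4 gates asym, D1
and NE2/3/4.»

WHAT (level `l → l+1`, every `ε` with `|ε| ≤ 1`, rate `0 ≤ δ`; letters `S X R R″ cH′` + parities `hC hR hR″` as in PART 2; in-block root, `1 ≤ Lc`, border data `hBff hBmm hB`; generic `d`):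
**`slotLetters_halfMember_succ_of_rows`** — HYPOTHESES: (i) p2's F4 row of the dressed source `hbF4 : LocStencil₂ (b̃_l) Cb δ`; (ii) TWO DISPLAYED S-slot letter rows on the
slaved summand table `E_l(p) := (c₄·(Lc^{d+1})⁻¹∕2) • (e3OfK Lc K♮ᴱ_l G₁^{ε}(p) + e3OfK Lc K♮ᴱ_l G₂^{ε}(p))`, `G^{ε}(p) := (sf_l·sm_l)⁻¹ • unitS_l (cH′⁻¹ • (((1+ε)∕2) • (S ∘ X_p −
X_p ∘ S) + ((1−ε)∕2) • R p))` — `hE₁ : LocStencil₂ (fun _ p κ′ u′ ↦ E_l(p) κ′ u′) CE₁ δ` (read at the passive slot, centred at the divergence site `p`) and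
`hE₂ : LocStencil₂ (fun κ u _ p ↦ E_l(p) κ u) CE₂ δ` (read at the active slot, centred at it);  CONCLUSION: leaf-03's rows for `Y := y_{l+1}`:
`LocStencil₂ (fun _ p κ′ u′ ↦ divV (κ₁ u₁ ↦ y_{l+1} κ₁ u₁ κ′ u′) p) ((d+1)(e^{3δ}+1)·Cb + CE₁) δ ∧ LocStencil₂ (fun κ u _ p ↦ divV (κ₁ u₁ ↦ y_{l+1} κ u κ₁ u₁) p) ((d+1)(e^{δ}+1)·Cb + CE₂) δ`
— PART 2's `divW_halfMember_succ_eq_slaved` ∕ `divV_snd_halfMember_succ_eq_slaved` (both slots), the OWNER's `T2ShapeEvenEnd.locStencil₂_halfTable` (the halved source keeps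
F4's constants, `|ε| ≤ 1`), leaf-02 g53's `SlotDivergenceLetters.letter_fst ∕ letter_snd_of_locStencil₂` (the ι-WIN letters), `WSlotT2OfPieces.locStencil₂_add`.
At `ε = 1` the rows (ii) carry NO `R` (`((1−1)∕2) • R`); member `y_0`'s letters come from the Wilson ∕ border tables directly (not here).  Asserts NOTHING about Bałaban's
tables; 0 estimate; rows (i)(ii) and the table laws are HYPOTHESES; discharges NOTHING of `hcell` ∕ (Q-L) ∕ (Q-S) ∕ (C) ∕ «T2Shape» ∕ «T2Drift» ∕ (hW, hWall); (β)
untouched; NEVER «G-an2-4 closed» as (CONV-C); NOT D1, NOT `BetaPertH`, NOT continuum, NOT Clay.  2026-08-23.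
-/

noncomputable section

open Finset
open scoped BigOperators
open Literature.MathematicalPhysics.QuantumFieldTheory
open Literature.MathematicalPhysics.QuantumFieldTheory.Balaban1983to89
open Literature.MathematicalPhysics.QuantumFieldTheory.Balaban1983to89.Beta
open ExpKernelCalculus (MKer Decays comp)
open OneStepResolventKernel (Fib)
open OneStepKernelFamily (KInvStep)
open SecondOrderResponse (W2SymOfK)
open BalabanStepJetsSucc (mmRead)
open BalabanStepW2 (K3OfK M2Of)
open KernelWard (divV divW)
open AffineAveraging (box toSite)
open BalabanCompositeJets (LocStencil₂)
open AveragingMixedJetTables (mixFFAt)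
open Summit.QuantumFields.BalabanUV.Beta.TameKernelCalculus (trK)
open Summit.QuantumFields.BalabanUV.Beta.BorderedHessian (sgnK)
open Summit.QuantumFields.BalabanUV.Beta.HessKerDressedUnits (unitK unitS)
open Summit.QuantumFields.BalabanUV.Beta.SecondOrderUnits (unitM unitS₂ unitM₂)
open Summit.QuantumFields.BalabanUV.Beta.AxialDressingRooted (coDressKBmAt)
open Summit.QuantumFields.BalabanUV.Beta.SpineRooted (T2RecAt SpureRecAt M1At e3OfK)
open Summit.QuantumFields.BalabanUV.Beta.GAN24.CombesThomas (sfStep smStep)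
open Summit.QuantumFields.BalabanUV.Beta.GAN24.BiStencilZeroMode (Tab)
open Summit.QuantumFields.BalabanUV.Beta.GAN24.WSlotT2OfPieces (locStencil₂_add)
open Summit.QuantumFields.BalabanUV.Beta.GAN24.SlotDivergenceLetters (letter_fst_of_locStencil₂ letter_snd_of_locStencil₂)
open Summit.QuantumFields.BalabanUV.Beta.GAN24.T2ShapeEvenEnd (locStencil₂_halfTable)
open Summit.QuantumFields.BalabanUV.Beta.GAN24.HalfMemberSlavedDivergenceComb (divW_halfMember_succ_eq_slaved divV_snd_halfMember_succ_eq_slaved)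

namespace Summit.QuantumFields.BalabanUV.Beta.GAN24.HalfMemberSlavedDivergenceLetters

variable {d : ℕ} {Lc : ℕ} [NeZero Lc] {r : Fin (d + 1) → ℕ}

/-! ## §4 The two slot-divergence letter rows of `y_{l+1}` -/

/-- NOT IN PRINT; OUR BOOKKEEPING.  **THE SLOT LETTERS OF THE `ε`-MEMBER ONE LEVEL UP** (leaf-03 g66's `h₁ ∕ h₂` spellings for `Y := y_{l+1}`): from p2's F4 row of
the dressed source `b̃_l` (halved by the OWNER's `locStencil₂_halfTable`, `|ε| ≤ 1`; leaf-02's ι-WIN letters) and ONE displayed S-slot letter row per slot on the slaved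
`e3OfK` summands `E_l(p)` (PART 2 §3 ∕ §3b letters `S X R R″ cH′`, parities `hC hR hR″`) — `locStencil₂_add` of the two. -/
theorem slotLetters_halfMember_succ_of_rows (hLc : 1 ≤ Lc) (hr : r ∈ box (d + 1) Lc) (cE cVH cΛ cE₂ cB : ℝ) (Tc : Fin 4 → Fin 4 → Fin 4 → Fin 4 → ℝ)
    {vh₂S : Tab d} (hBff : ∀ κ u κ' u' x z (α β : Fin (d + 1)), vh₂S κ u κ' u' x z (Sum.inl α) (Sum.inl β) = 0)
    (hBmm : ∀ κ u κ' u' x z (μ ν : Fin (d + 1)), vh₂S κ u κ' u' x z (Sum.inr μ) (Sum.inr ν) = 0)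
    (hB : ∃ C δ : ℝ, 0 < δ ∧ LocStencil₂ vh₂S C δ) (l : ℕ)
    {S : Fin (d + 1) → (Fin (d + 1) → ℤ) → MKer (d + 1) (Fib d)} {X : (Fin (d + 1) → ℤ) → MKer (d + 1) (Fib d)}
    {R R'' : (Fin (d + 1) → ℤ) → Fin (d + 1) → (Fin (d + 1) → ℤ) → MKer (d + 1) (Fib d)} {cH' : ℝ} (hcH : cH' ≠ 0)
    (hTL : ∀ (Y : Fin (d + 1) → ℤ) (κ' : Fin (d + 1)) (u' : Fin (d + 1) → ℤ),
      cH' • ∑ v ∈ box (d + 1) Lc, divV (fun κ u => T2RecAt d Lc (toSite r) cE cVH cΛ cE₂ cB Tc vh₂S (mixFFAt (toSite r) Lc) l κ u κ' u') ((Lc : ℤ) • Y + toSite v)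
        = comp (S κ' u') (X Y) - comp (X Y) (S κ' u') + R Y κ' u')
    (hTL'' : ∀ (Y : Fin (d + 1) → ℤ) (κ : Fin (d + 1)) (u : Fin (d + 1) → ℤ),
      cH' • ∑ v ∈ box (d + 1) Lc, divV (T2RecAt d Lc (toSite r) cE cVH cΛ cE₂ cB Tc vh₂S (mixFFAt (toSite r) Lc) l κ u) ((Lc : ℤ) • Y + toSite v)
        = comp (S κ u) (X Y) - comp (X Y) (S κ u) + R'' Y κ u)
    (hC : ∀ (Y : Fin (d + 1) → ℤ) (κ : Fin (d + 1)) (u : Fin (d + 1) → ℤ),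
      trK (comp (S κ u) (X Y) - comp (X Y) (S κ u)) = sgnK (comp (S κ u) (X Y) - comp (X Y) (S κ u)))
    (hR : ∀ (Y : Fin (d + 1) → ℤ) (κ : Fin (d + 1)) (u : Fin (d + 1) → ℤ), trK (R Y κ u) = -sgnK (R Y κ u))
    (hR'' : ∀ (Y : Fin (d + 1) → ℤ) (κ : Fin (d + 1)) (u : Fin (d + 1) → ℤ), trK (R'' Y κ u) = -sgnK (R'' Y κ u))
    (ε : ℝ) (hε : |ε| ≤ 1) {Cb CE₁ CE₂ δ : ℝ} (hδ : 0 ≤ δ)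
    (hbF4 : LocStencil₂ (fun κ u κ' u' => (cE₂ * (Lc : ℝ) ^ (2 * (d + 1))) • mmRead Lc (K3OfK
            (unitK (sfStep Lc l) (smStep d Lc l) (coDressKBmAt (toSite r) Lc (KInvStep (d := d) Lc l))) Lc
            (unitS (sfStep Lc l) (smStep d Lc l) (SpureRecAt d Lc (toSite r) cE cVH cΛ l)) (unitM (sfStep Lc l) (smStep d Lc l) (M1At d Lc (toSite r) cΛ l))
            (W2SymOfK (unitK (sfStep Lc l) (smStep d Lc l) (coDressKBmAt (toSite r) Lc (KInvStep (d := d) Lc l))) Lc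
              (unitS (sfStep Lc l) (smStep d Lc l) (SpureRecAt d Lc (toSite r) cE cVH cΛ l)) (unitM (sfStep Lc l) (smStep d Lc l) (M1At d Lc (toSite r) cΛ l)) 0
              (unitM₂ (sfStep Lc l) (smStep d Lc l) (M2Of d Lc (mixFFAt (toSite r) Lc) l))) κ u κ' u') + cB • vh₂S κ u κ' u') Cb δ)
    (hE₁ : LocStencil₂ (fun (_ : Fin (d + 1)) (p : Fin (d + 1) → ℤ) (κ' : Fin (d + 1)) (u' : Fin (d + 1) → ℤ) =>
          (cE₂ * (Lc : ℝ) ^ (2 * (d + 1)) * ((Lc : ℝ) ^ (d + 1))⁻¹ / 2) •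
            (e3OfK Lc (unitK (sfStep Lc l) (smStep d Lc l) (coDressKBmAt (toSite r) Lc (KInvStep (d := d) Lc l)))
              (fun κ' u' => (sfStep Lc l * smStep d Lc l)⁻¹ • unitS (sfStep Lc l) (smStep d Lc l)
                (fun κ' u' => cH'⁻¹ • ((((1 : ℝ) + ε) / 2) • (comp (S κ' u') (X p) - comp (X p) (S κ' u')) + (((1 : ℝ) - ε) / 2) • R p κ' u')) κ' u') κ' u'
            + e3OfK Lc (unitK (sfStep Lc l) (smStep d Lc l) (coDressKBmAt (toSite r) Lc (KInvStep (d := d) Lc l)))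
              (fun κ u => (sfStep Lc l * smStep d Lc l)⁻¹ • unitS (sfStep Lc l) (smStep d Lc l)
                (fun κ u => cH'⁻¹ • ((((1 : ℝ) + ε) / 2) • (comp (S κ u) (X p) - comp (X p) (S κ u)) + (((1 : ℝ) - ε) / 2) • R'' p κ u)) κ u) κ' u')) CE₁ δ)
    (hE₂ : LocStencil₂ (fun (κ : Fin (d + 1)) (u : Fin (d + 1) → ℤ) (_ : Fin (d + 1)) (p : Fin (d + 1) → ℤ) =>
          (cE₂ * (Lc : ℝ) ^ (2 * (d + 1)) * ((Lc : ℝ) ^ (d + 1))⁻¹ / 2) •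
            (e3OfK Lc (unitK (sfStep Lc l) (smStep d Lc l) (coDressKBmAt (toSite r) Lc (KInvStep (d := d) Lc l)))
              (fun κ' u' => (sfStep Lc l * smStep d Lc l)⁻¹ • unitS (sfStep Lc l) (smStep d Lc l)
                (fun κ' u' => cH'⁻¹ • ((((1 : ℝ) + ε) / 2) • (comp (S κ' u') (X p) - comp (X p) (S κ' u')) + (((1 : ℝ) - ε) / 2) • R p κ' u')) κ' u') κ u
            + e3OfK Lc (unitK (sfStep Lc l) (smStep d Lc l) (coDressKBmAt (toSite r) Lc (KInvStep (d := d) Lc l)))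
              (fun κ u => (sfStep Lc l * smStep d Lc l)⁻¹ • unitS (sfStep Lc l) (smStep d Lc l)
                (fun κ u => cH'⁻¹ • ((((1 : ℝ) + ε) / 2) • (comp (S κ u) (X p) - comp (X p) (S κ u)) + (((1 : ℝ) - ε) / 2) • R'' p κ u)) κ u) κ u)) CE₂ δ) :
    LocStencil₂ (fun (_ : Fin (d + 1)) (p : Fin (d + 1) → ℤ) (κ' : Fin (d + 1)) (u' : Fin (d + 1) → ℤ) =>
        divV (fun κ₁ u₁ => ((1 / 2 : ℝ) • (unitS₂ (sfStep Lc (l + 1)) (smStep d Lc (l + 1)) (T2RecAt d Lc (toSite r) cE cVH cΛ cE₂ cB Tc vh₂S (mixFFAt (toSite r) Lc) (l + 1))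
          + ε • fun κ u κ' u' => sgnK (trK (unitS₂ (sfStep Lc (l + 1)) (smStep d Lc (l + 1)) (T2RecAt d Lc (toSite r) cE cVH cΛ cE₂ cB Tc vh₂S (mixFFAt (toSite r) Lc) (l + 1)) κ u κ' u')))) κ₁ u₁ κ' u') p)
      (((d : ℝ) + 1) * (Real.exp (3 * δ) + 1) * Cb + CE₁) δ
    ∧ LocStencil₂ (fun (κ : Fin (d + 1)) (u : Fin (d + 1) → ℤ) (_ : Fin (d + 1)) (p : Fin (d + 1) → ℤ) =>
        divV (fun κ₁ u₁ => ((1 / 2 : ℝ) • (unitS₂ (sfStep Lc (l + 1)) (smStep d Lc (l + 1)) (T2RecAt d Lc (toSite r) cE cVH cΛ cE₂ cB Tc vh₂S (mixFFAt (toSite r) Lc) (l + 1))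
          + ε • fun κ u κ' u' => sgnK (trK (unitS₂ (sfStep Lc (l + 1)) (smStep d Lc (l + 1)) (T2RecAt d Lc (toSite r) cE cVH cΛ cE₂ cB Tc vh₂S (mixFFAt (toSite r) Lc) (l + 1)) κ u κ' u')))) κ u κ₁ u₁) p)
      (((d : ℝ) + 1) * (Real.exp δ + 1) * Cb + CE₂) δ := by
  -- the halved dressed source keeps F4's constants
  have hb : LocStencil₂ ((1 / 2 : ℝ) • ((fun κ u κ' u' => (cE₂ * (Lc : ℝ) ^ (2 * (d + 1))) • mmRead Lc (K3OfK
            (unitK (sfStep Lc l) (smStep d Lc l) (coDressKBmAt (toSite r) Lc (KInvStep (d := d) Lc l))) Lc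
            (unitS (sfStep Lc l) (smStep d Lc l) (SpureRecAt d Lc (toSite r) cE cVH cΛ l)) (unitM (sfStep Lc l) (smStep d Lc l) (M1At d Lc (toSite r) cΛ l))
            (W2SymOfK (unitK (sfStep Lc l) (smStep d Lc l) (coDressKBmAt (toSite r) Lc (KInvStep (d := d) Lc l))) Lc
              (unitS (sfStep Lc l) (smStep d Lc l) (SpureRecAt d Lc (toSite r) cE cVH cΛ l)) (unitM (sfStep Lc l) (smStep d Lc l) (M1At d Lc (toSite r) cΛ l)) 0
              (unitM₂ (sfStep Lc l) (smStep d Lc l) (M2Of d Lc (mixFFAt (toSite r) Lc) l))) κ u κ' u') + cB • vh₂S κ u κ' u')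
          + ε • fun κ u κ' u' => sgnK (trK ((fun κ u κ' u' => (cE₂ * (Lc : ℝ) ^ (2 * (d + 1))) • mmRead Lc (K3OfK
            (unitK (sfStep Lc l) (smStep d Lc l) (coDressKBmAt (toSite r) Lc (KInvStep (d := d) Lc l))) Lc
            (unitS (sfStep Lc l) (smStep d Lc l) (SpureRecAt d Lc (toSite r) cE cVH cΛ l)) (unitM (sfStep Lc l) (smStep d Lc l) (M1At d Lc (toSite r) cΛ l))
            (W2SymOfK (unitK (sfStep Lc l) (smStep d Lc l) (coDressKBmAt (toSite r) Lc (KInvStep (d := d) Lc l))) Lc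
              (unitS (sfStep Lc l) (smStep d Lc l) (SpureRecAt d Lc (toSite r) cE cVH cΛ l)) (unitM (sfStep Lc l) (smStep d Lc l) (M1At d Lc (toSite r) cΛ l)) 0
              (unitM₂ (sfStep Lc l) (smStep d Lc l) (M2Of d Lc (mixFFAt (toSite r) Lc) l))) κ u κ' u') + cB • vh₂S κ u κ' u') κ u κ' u')))) Cb δ :=
    locStencil₂_halfTable hbF4 hε
  constructor
  · -- first slot: PART 2 §3 pointwise, then the ι-WIN letter + the displayed row
    have hA : LocStencil₂ (fun (_ : Fin (d + 1)) (p : Fin (d + 1) → ℤ) (κ' : Fin (d + 1)) (u' : Fin (d + 1) → ℤ) =>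
        divV (fun κ₁ u₁ => ((1 / 2 : ℝ) • ((fun κ u κ' u' => (cE₂ * (Lc : ℝ) ^ (2 * (d + 1))) • mmRead Lc (K3OfK
            (unitK (sfStep Lc l) (smStep d Lc l) (coDressKBmAt (toSite r) Lc (KInvStep (d := d) Lc l))) Lc
            (unitS (sfStep Lc l) (smStep d Lc l) (SpureRecAt d Lc (toSite r) cE cVH cΛ l)) (unitM (sfStep Lc l) (smStep d Lc l) (M1At d Lc (toSite r) cΛ l))
            (W2SymOfK (unitK (sfStep Lc l) (smStep d Lc l) (coDressKBmAt (toSite r) Lc (KInvStep (d := d) Lc l))) Lc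
              (unitS (sfStep Lc l) (smStep d Lc l) (SpureRecAt d Lc (toSite r) cE cVH cΛ l)) (unitM (sfStep Lc l) (smStep d Lc l) (M1At d Lc (toSite r) cΛ l)) 0
              (unitM₂ (sfStep Lc l) (smStep d Lc l) (M2Of d Lc (mixFFAt (toSite r) Lc) l))) κ u κ' u') + cB • vh₂S κ u κ' u')
          + ε • fun κ u κ' u' => sgnK (trK ((fun κ u κ' u' => (cE₂ * (Lc : ℝ) ^ (2 * (d + 1))) • mmRead Lc (K3OfK
            (unitK (sfStep Lc l) (smStep d Lc l) (coDressKBmAt (toSite r) Lc (KInvStep (d := d) Lc l))) Lc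
            (unitS (sfStep Lc l) (smStep d Lc l) (SpureRecAt d Lc (toSite r) cE cVH cΛ l)) (unitM (sfStep Lc l) (smStep d Lc l) (M1At d Lc (toSite r) cΛ l))
            (W2SymOfK (unitK (sfStep Lc l) (smStep d Lc l) (coDressKBmAt (toSite r) Lc (KInvStep (d := d) Lc l))) Lc
              (unitS (sfStep Lc l) (smStep d Lc l) (SpureRecAt d Lc (toSite r) cE cVH cΛ l)) (unitM (sfStep Lc l) (smStep d Lc l) (M1At d Lc (toSite r) cΛ l)) 0
              (unitM₂ (sfStep Lc l) (smStep d Lc l) (M2Of d Lc (mixFFAt (toSite r) Lc) l))) κ u κ' u') + cB • vh₂S κ u κ' u') κ u κ' u')))) κ₁ u₁ κ' u') p) (((d : ℝ) + 1) * (Real.exp (3 * δ) + 1) * Cb) δ :=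
      fun _ p κ' u' x z a b => letter_fst_of_locStencil₂ hb hδ p κ' u' x z a b
    have e : (fun (_ : Fin (d + 1)) (p : Fin (d + 1) → ℤ) (κ' : Fin (d + 1)) (u' : Fin (d + 1) → ℤ) =>
          divV (fun κ₁ u₁ => ((1 / 2 : ℝ) • (unitS₂ (sfStep Lc (l + 1)) (smStep d Lc (l + 1)) (T2RecAt d Lc (toSite r) cE cVH cΛ cE₂ cB Tc vh₂S (mixFFAt (toSite r) Lc) (l + 1))
          + ε • fun κ u κ' u' => sgnK (trK (unitS₂ (sfStep Lc (l + 1)) (smStep d Lc (l + 1)) (T2RecAt d Lc (toSite r) cE cVH cΛ cE₂ cB Tc vh₂S (mixFFAt (toSite r) Lc) (l + 1)) κ u κ' u')))) κ₁ u₁ κ' u') p)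
        = (fun (_ : Fin (d + 1)) (p : Fin (d + 1) → ℤ) (κ' : Fin (d + 1)) (u' : Fin (d + 1) → ℤ) =>
            divV (fun κ₁ u₁ => ((1 / 2 : ℝ) • ((fun κ u κ' u' => (cE₂ * (Lc : ℝ) ^ (2 * (d + 1))) • mmRead Lc (K3OfK
            (unitK (sfStep Lc l) (smStep d Lc l) (coDressKBmAt (toSite r) Lc (KInvStep (d := d) Lc l))) Lc
            (unitS (sfStep Lc l) (smStep d Lc l) (SpureRecAt d Lc (toSite r) cE cVH cΛ l)) (unitM (sfStep Lc l) (smStep d Lc l) (M1At d Lc (toSite r) cΛ l))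
            (W2SymOfK (unitK (sfStep Lc l) (smStep d Lc l) (coDressKBmAt (toSite r) Lc (KInvStep (d := d) Lc l))) Lc
              (unitS (sfStep Lc l) (smStep d Lc l) (SpureRecAt d Lc (toSite r) cE cVH cΛ l)) (unitM (sfStep Lc l) (smStep d Lc l) (M1At d Lc (toSite r) cΛ l)) 0
              (unitM₂ (sfStep Lc l) (smStep d Lc l) (M2Of d Lc (mixFFAt (toSite r) Lc) l))) κ u κ' u') + cB • vh₂S κ u κ' u')
          + ε • fun κ u κ' u' => sgnK (trK ((fun κ u κ' u' => (cE₂ * (Lc : ℝ) ^ (2 * (d + 1))) • mmRead Lc (K3OfK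
            (unitK (sfStep Lc l) (smStep d Lc l) (coDressKBmAt (toSite r) Lc (KInvStep (d := d) Lc l))) Lc
            (unitS (sfStep Lc l) (smStep d Lc l) (SpureRecAt d Lc (toSite r) cE cVH cΛ l)) (unitM (sfStep Lc l) (smStep d Lc l) (M1At d Lc (toSite r) cΛ l))
            (W2SymOfK (unitK (sfStep Lc l) (smStep d Lc l) (coDressKBmAt (toSite r) Lc (KInvStep (d := d) Lc l))) Lc
              (unitS (sfStep Lc l) (smStep d Lc l) (SpureRecAt d Lc (toSite r) cE cVH cΛ l)) (unitM (sfStep Lc l) (smStep d Lc l) (M1At d Lc (toSite r) cΛ l)) 0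
              (unitM₂ (sfStep Lc l) (smStep d Lc l) (M2Of d Lc (mixFFAt (toSite r) Lc) l))) κ u κ' u') + cB • vh₂S κ u κ' u') κ u κ' u')))) κ₁ u₁ κ' u') p)
          + (fun (_ : Fin (d + 1)) (p : Fin (d + 1) → ℤ) (κ' : Fin (d + 1)) (u' : Fin (d + 1) → ℤ) =>
            (cE₂ * (Lc : ℝ) ^ (2 * (d + 1)) * ((Lc : ℝ) ^ (d + 1))⁻¹ / 2) •
            (e3OfK Lc (unitK (sfStep Lc l) (smStep d Lc l) (coDressKBmAt (toSite r) Lc (KInvStep (d := d) Lc l)))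
              (fun κ' u' => (sfStep Lc l * smStep d Lc l)⁻¹ • unitS (sfStep Lc l) (smStep d Lc l)
                (fun κ' u' => cH'⁻¹ • ((((1 : ℝ) + ε) / 2) • (comp (S κ' u') (X p) - comp (X p) (S κ' u')) + (((1 : ℝ) - ε) / 2) • R p κ' u')) κ' u') κ' u'
            + e3OfK Lc (unitK (sfStep Lc l) (smStep d Lc l) (coDressKBmAt (toSite r) Lc (KInvStep (d := d) Lc l)))
              (fun κ u => (sfStep Lc l * smStep d Lc l)⁻¹ • unitS (sfStep Lc l) (smStep d Lc l)
                (fun κ u => cH'⁻¹ • ((((1 : ℝ) + ε) / 2) • (comp (S κ u) (X p) - comp (X p) (S κ u)) + (((1 : ℝ) - ε) / 2) • R'' p κ u)) κ u) κ' u')) := by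
      funext i p κ' u'
      exact divW_halfMember_succ_eq_slaved hLc hr cE cVH cΛ cE₂ cB Tc hBff hBmm hB l hcH hTL hTL'' hC hR hR'' ε p κ' u'
    rw [e]
    exact locStencil₂_add hA hE₁
  · -- second slot: PART 2 §3b pointwise, then the ι-WIN letter + the displayed row
    have hA : LocStencil₂ (fun (κ : Fin (d + 1)) (u : Fin (d + 1) → ℤ) (_ : Fin (d + 1)) (p : Fin (d + 1) → ℤ) =>
        divV (fun κ₁ u₁ => ((1 / 2 : ℝ) • ((fun κ u κ' u' => (cE₂ * (Lc : ℝ) ^ (2 * (d + 1))) • mmRead Lc (K3OfK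
            (unitK (sfStep Lc l) (smStep d Lc l) (coDressKBmAt (toSite r) Lc (KInvStep (d := d) Lc l))) Lc
            (unitS (sfStep Lc l) (smStep d Lc l) (SpureRecAt d Lc (toSite r) cE cVH cΛ l)) (unitM (sfStep Lc l) (smStep d Lc l) (M1At d Lc (toSite r) cΛ l))
            (W2SymOfK (unitK (sfStep Lc l) (smStep d Lc l) (coDressKBmAt (toSite r) Lc (KInvStep (d := d) Lc l))) Lc
              (unitS (sfStep Lc l) (smStep d Lc l) (SpureRecAt d Lc (toSite r) cE cVH cΛ l)) (unitM (sfStep Lc l) (smStep d Lc l) (M1At d Lc (toSite r) cΛ l)) 0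
              (unitM₂ (sfStep Lc l) (smStep d Lc l) (M2Of d Lc (mixFFAt (toSite r) Lc) l))) κ u κ' u') + cB • vh₂S κ u κ' u')
          + ε • fun κ u κ' u' => sgnK (trK ((fun κ u κ' u' => (cE₂ * (Lc : ℝ) ^ (2 * (d + 1))) • mmRead Lc (K3OfK
            (unitK (sfStep Lc l) (smStep d Lc l) (coDressKBmAt (toSite r) Lc (KInvStep (d := d) Lc l))) Lc
            (unitS (sfStep Lc l) (smStep d Lc l) (SpureRecAt d Lc (toSite r) cE cVH cΛ l)) (unitM (sfStep Lc l) (smStep d Lc l) (M1At d Lc (toSite r) cΛ l))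
            (W2SymOfK (unitK (sfStep Lc l) (smStep d Lc l) (coDressKBmAt (toSite r) Lc (KInvStep (d := d) Lc l))) Lc
              (unitS (sfStep Lc l) (smStep d Lc l) (SpureRecAt d Lc (toSite r) cE cVH cΛ l)) (unitM (sfStep Lc l) (smStep d Lc l) (M1At d Lc (toSite r) cΛ l)) 0
              (unitM₂ (sfStep Lc l) (smStep d Lc l) (M2Of d Lc (mixFFAt (toSite r) Lc) l))) κ u κ' u') + cB • vh₂S κ u κ' u') κ u κ' u')))) κ u κ₁ u₁) p) (((d : ℝ) + 1) * (Real.exp δ + 1) * Cb) δ :=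
      fun κ u _ p x z a b => letter_snd_of_locStencil₂ hb hδ κ u p x z a b
    have e : (fun (κ : Fin (d + 1)) (u : Fin (d + 1) → ℤ) (_ : Fin (d + 1)) (p : Fin (d + 1) → ℤ) =>
          divV (fun κ₁ u₁ => ((1 / 2 : ℝ) • (unitS₂ (sfStep Lc (l + 1)) (smStep d Lc (l + 1)) (T2RecAt d Lc (toSite r) cE cVH cΛ cE₂ cB Tc vh₂S (mixFFAt (toSite r) Lc) (l + 1))
          + ε • fun κ u κ' u' => sgnK (trK (unitS₂ (sfStep Lc (l + 1)) (smStep d Lc (l + 1)) (T2RecAt d Lc (toSite r) cE cVH cΛ cE₂ cB Tc vh₂S (mixFFAt (toSite r) Lc) (l + 1)) κ u κ' u')))) κ u κ₁ u₁) p)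
        = (fun (κ : Fin (d + 1)) (u : Fin (d + 1) → ℤ) (_ : Fin (d + 1)) (p : Fin (d + 1) → ℤ) =>
            divV (fun κ₁ u₁ => ((1 / 2 : ℝ) • ((fun κ u κ' u' => (cE₂ * (Lc : ℝ) ^ (2 * (d + 1))) • mmRead Lc (K3OfK
            (unitK (sfStep Lc l) (smStep d Lc l) (coDressKBmAt (toSite r) Lc (KInvStep (d := d) Lc l))) Lc
            (unitS (sfStep Lc l) (smStep d Lc l) (SpureRecAt d Lc (toSite r) cE cVH cΛ l)) (unitM (sfStep Lc l) (smStep d Lc l) (M1At d Lc (toSite r) cΛ l))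
            (W2SymOfK (unitK (sfStep Lc l) (smStep d Lc l) (coDressKBmAt (toSite r) Lc (KInvStep (d := d) Lc l))) Lc
              (unitS (sfStep Lc l) (smStep d Lc l) (SpureRecAt d Lc (toSite r) cE cVH cΛ l)) (unitM (sfStep Lc l) (smStep d Lc l) (M1At d Lc (toSite r) cΛ l)) 0
              (unitM₂ (sfStep Lc l) (smStep d Lc l) (M2Of d Lc (mixFFAt (toSite r) Lc) l))) κ u κ' u') + cB • vh₂S κ u κ' u')
          + ε • fun κ u κ' u' => sgnK (trK ((fun κ u κ' u' => (cE₂ * (Lc : ℝ) ^ (2 * (d + 1))) • mmRead Lc (K3OfK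
            (unitK (sfStep Lc l) (smStep d Lc l) (coDressKBmAt (toSite r) Lc (KInvStep (d := d) Lc l))) Lc
            (unitS (sfStep Lc l) (smStep d Lc l) (SpureRecAt d Lc (toSite r) cE cVH cΛ l)) (unitM (sfStep Lc l) (smStep d Lc l) (M1At d Lc (toSite r) cΛ l))
            (W2SymOfK (unitK (sfStep Lc l) (smStep d Lc l) (coDressKBmAt (toSite r) Lc (KInvStep (d := d) Lc l))) Lc
              (unitS (sfStep Lc l) (smStep d Lc l) (SpureRecAt d Lc (toSite r) cE cVH cΛ l)) (unitM (sfStep Lc l) (smStep d Lc l) (M1At d Lc (toSite r) cΛ l)) 0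
              (unitM₂ (sfStep Lc l) (smStep d Lc l) (M2Of d Lc (mixFFAt (toSite r) Lc) l))) κ u κ' u') + cB • vh₂S κ u κ' u') κ u κ' u')))) κ u κ₁ u₁) p)
          + (fun (κ : Fin (d + 1)) (u : Fin (d + 1) → ℤ) (_ : Fin (d + 1)) (p : Fin (d + 1) → ℤ) =>
            (cE₂ * (Lc : ℝ) ^ (2 * (d + 1)) * ((Lc : ℝ) ^ (d + 1))⁻¹ / 2) •
            (e3OfK Lc (unitK (sfStep Lc l) (smStep d Lc l) (coDressKBmAt (toSite r) Lc (KInvStep (d := d) Lc l)))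
              (fun κ' u' => (sfStep Lc l * smStep d Lc l)⁻¹ • unitS (sfStep Lc l) (smStep d Lc l)
                (fun κ' u' => cH'⁻¹ • ((((1 : ℝ) + ε) / 2) • (comp (S κ' u') (X p) - comp (X p) (S κ' u')) + (((1 : ℝ) - ε) / 2) • R p κ' u')) κ' u') κ u
            + e3OfK Lc (unitK (sfStep Lc l) (smStep d Lc l) (coDressKBmAt (toSite r) Lc (KInvStep (d := d) Lc l)))
              (fun κ u => (sfStep Lc l * smStep d Lc l)⁻¹ • unitS (sfStep Lc l) (smStep d Lc l)
                (fun κ u => cH'⁻¹ • ((((1 : ℝ) + ε) / 2) • (comp (S κ u) (X p) - comp (X p) (S κ u)) + (((1 : ℝ) - ε) / 2) • R'' p κ u)) κ u) κ u)) := by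
      funext κ u i p
      exact divV_snd_halfMember_succ_eq_slaved hLc hr cE cVH cΛ cE₂ cB Tc hBff hBmm hB l hcH hTL hTL'' hC hR hR'' ε p κ u
    rw [e]
    exact locStencil₂_add hA hE₂

end Summit.QuantumFields.BalabanUV.Beta.GAN24.HalfMemberSlavedDivergenceLetters

end
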